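import Literature.MathematicalPhysics.QuantumFieldTheory.Balaban1983to89.B3GkZeroLattice

/-!
# `Balaban1983to89.B3GkZeroLatticeSeparated` — T. Bałaban, *(Higgs)₂,₃ quantum fields in a finite volume. III. Renormalization*,
# Commun. Math. Phys. **88** (1983) 411–445 [Balaban1983Higgs3], (3.1) p. 432 for the §3 propagator `G_k(0)` on `ηℤ^{d+1}`
# (p. 433 *"with the scalar field propagator equal to G_k(0)"*): the SIX KERNEL CLAUSES of the infinite-volume zero-field
# propagator AT SEPARATED ARGUMENTS `η|x−x′|_∞ ≥ ρ` — value, lattice derivative in either variable, Hölder quotients of these,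
# mixed second difference — each `≤ C(ρ)·e^{−δ₀η|x−x′|_∞}` with NO singular prefactor, uniformly in the scale `k ≥ 1` and the
# window: the limits `t → ∞` of gen-5's clauses `B3GkZeroBoxSeparated` for the cube propagators `G_k(C_t,0)`

statement-level skeleton of published theorems with citation tags; proofs where landed; nothing here is a claim about the Yang–Mills mass gap

PDF held: `paper:balaban1983-higgs-2-3-quantum-fields-finite-volume` (journal page = PDF page + 410); p. 432 [PDF 22] ((3.1)),
p. 433 [PDF 23] read in the OCR text (`p0022.txt`, `p0023.txt`).

CITATION HEADER (lean-in-tree rule).  Part of the lit-balaban TYPED SKELETON (HOME `run/shared/lean/pub/lit-balaban/`), Phase 2: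
SKELETON row **B3.Eq3.1** (decl of record `B3Sect3Statements.Sect3Data.Ineq31`, fold owner r15; proved members: zero-field box
`B3Ineq31ZeroBox` over `B3GkZeroBoxSeparated`, zero-field torus `B3Ineq31ZeroTorus`, constant-field box `B3Ineq31ConstBox`) and
**B3.Txt@433**: kernel clauses for the LATTICE member (the print's own §3 propagator `G_k(0)`, `B3GkZeroLattice.GkLat`).

WHAT IS PRINTED.  p. 432 [PDF 22], (3.1): *"Such a possibility is assured by the following estimates
‖hG_k(Ω,B̃)h′‖_{1,α} ≤ O(1)e^{−δ₀dist(□(v),□(v′))}, (3.1) and similarly for the vector field propagator, h, h′ are localization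
functions."* (p. 432 [PDF 22] L13–17; v1.2: quotation restored to print — v1/v1.1 had the paraphrase *"… vector field propagators."*,
ref-4 docfix note S-B3-g34-1, 2026-08-22).  p. 433: *"After all these operations we get a sum of the expressions … with the same
graphical description as before, but with the scalar field propagator equal to G_k(0)."*

WHAT IS REPRODUCED (kind «model-instance», G.1 of `HOME/PHASE2-TARGETS.md`).  For every separation `ρ > 0` there are `δ₀, C > 0`
(on `d`, `L`, the window, `ρ`, and `α` for the Hölder clauses) such that for every `k ≥ 1` (`n = L^k = η^{−1}`), window point and
lattice points with `ρn ≤ |x−x′|_∞` (for the Hölder clauses: `≤` the minimum over the two row/column points):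
**`abs_GkLat_sep_le`** `n^{d+1}|G_k(0)(x,x′)| ≤ C·e^{−δ₀|x−x′|_∞/n}`; **`abs_GkLatDiff_sep_le`** / **`abs_GkLatDiff'_sep_le`**
(`n^{d+1}·n·|G_k(0)(x+e_μ,x′) − G_k(0)(x,x′)|`, and in the column variable); **`abs_GkLatDD_sep_le`** / **`abs_GkLatDD'_sep_le`**
(Hölder quotients `(n/|x₂−x₁|_∞)^α·n^{d+1}·n·|…|`, per `0 ≤ α < 1`); **`abs_GkLatMixed_sep_le`** (`n^{d+1}·n²·|mixed second
difference|`) — each the gen-5 clause of the same name (`B3GkZeroBoxSeparated`, from (2.6) + (2.10)/(2.11) summed over the scales)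
applied to the cube `C_t` at the centred points and passed to the limit with `B3GkZeroLattice.tendsto_gcube`; on the lattice every
point HAS all its neighbours, so no membership side condition remains.

HONEST SCOPE / DECLARED DIVERGENCES (F7).  (i) Zero field, `G_k(0)` the kernel limit of `B3GkZeroLattice` (matrix units; physical
kernel `η^{−(d+1)}·GkLat`), all `k ≥ 1`, window `[a₋,a₊] × [0,m²₊]`.  (ii) Only SEPARATED arguments (`ρ > 0` fixed first; the
constants blow up as `ρ → 0`): nothing is said on the diagonal.  (iii) Sup norm, lattice units `× η`; constants existential.
(iv) This file does not assemble the norm (1.32) or the carrier `Sect3Data` (that would be the lattice twin of `B3Ineq31ZeroBox`).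
(v) ROUTE: gen-5's published route ((2.6) + (2.10) summed, kernel-proved on boxes) + the limit of file `B3GkZeroLattice`; used BY
NAME; theorems only, no Literature fact minted; standard axioms.  NOT summit progress.
Unit `lit-balaban-p03` (Phase-2 proof seat p03, gen 8); HOME `run/shared/lean/pub/lit-balaban/` (rows B3.Eq3.1 / B3.Txt@433).
-/

namespace Literature.MathematicalPhysics.QuantumFieldTheory.Balaban1983to89.B3GkZeroLatticeSeparated

open Finset Matrix Filter Topology
open Literature.MathematicalPhysics.QuantumFieldTheory.Balaban1983to89.B4ContourShift (supNorm supNorm_nonneg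
  abs_le_supNorm exists_supNorm_eq)
open Literature.MathematicalPhysics.QuantumFieldTheory.Balaban1983to89.B4TwoRegion120 (supNorm_sub_comm)
open Literature.MathematicalPhysics.QuantumFieldTheory.Balaban1983to89.B4Reflection242
open Literature.MathematicalPhysics.QuantumFieldTheory.Balaban1983to89.B4TwoBox120
open Literature.MathematicalPhysics.QuantumFieldTheory.Balaban1983to89.B4Thm110ZeroBox
open Literature.MathematicalPhysics.QuantumFieldTheory.Balaban1983to89.B3GkZeroBoxSeparated
open Literature.MathematicalPhysics.QuantumFieldTheory.Balaban1983to89.B3GkZeroLattice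

noncomputable section

variable {d : ℕ}

/-- kernel: a weighted absolute bound valid along a convergent sequence passes to the limit. [folklore] -/
private theorem mul_abs_le_of_tendsto {F : ℕ → ℝ} {A c B : ℝ} (hF : Tendsto F atTop (𝓝 A)) (T : ℕ)
    (hB : ∀ t, T ≤ t → c * |F t| ≤ B) : c * |A| ≤ B :=
  le_of_tendsto (hF.abs.const_mul c) (eventually_atTop.2 ⟨T, hB⟩)

/-- kernel: as `mul_abs_le_of_tendsto`, two weights. [folklore] -/
private theorem mul_abs_le_of_tendsto₂ {F : ℕ → ℝ} {A p q B : ℝ} (hF : Tendsto F atTop (𝓝 A)) (T : ℕ)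
    (hB : ∀ t, T ≤ t → p * (q * |F t|) ≤ B) : p * (q * |A|) ≤ B :=
  le_of_tendsto ((hF.abs.const_mul q).const_mul p) (eventually_atTop.2 ⟨T, hB⟩)

/-- kernel: as `mul_abs_le_of_tendsto`, three weights. [folklore] -/
private theorem mul_abs_le_of_tendsto₃ {F : ℕ → ℝ} {A w p q B : ℝ} (hF : Tendsto F atTop (𝓝 A)) (T : ℕ)
    (hB : ∀ t, T ≤ t → w * (p * (q * |F t|)) ≤ B) : w * (p * (q * |A|)) ≤ B :=
  le_of_tendsto (((hF.abs.const_mul q).const_mul p).const_mul w) (eventually_atTop.2 ⟨T, hB⟩)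

/-- kernel: a common label radius for five points. [folklore] -/
private theorem exists_labRad₅ (n : ℕ) (x₁ x₂ x₃ x₄ x₅ : Fin (d + 1) → ℤ) :
    ∃ R : ℕ, LabRad n R x₁ ∧ LabRad n R x₂ ∧ LabRad n R x₃ ∧ LabRad n R x₄ ∧ LabRad n R x₅ := by
  obtain ⟨R₁, h₁, h₂⟩ := exists_labRad₂ n x₁ x₂
  obtain ⟨R₂, h₃, h₄⟩ := exists_labRad₂ n x₃ x₄
  obtain ⟨R₃, h₅, -⟩ := exists_labRad₂ n x₅ x₅
  refine ⟨R₁ + R₂ + R₃, h₁.mono (by omega), h₂.mono (by omega), h₃.mono (by omega), h₄.mono (by omega), h₅.mono (by omega)⟩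

/-- kernel: centring a lattice neighbour gives the lattice neighbour of the centred point. [folklore] -/
private theorem ctr_add_single (n t : ℕ) (x : Fin (d + 1) → ℤ) (μ : Fin (d + 1)) :
    ctr n t (x + Pi.single μ 1) = ctr n t x + Pi.single μ 1 := by
  unfold ctr; abel

section Clauses

variable {ℓ k : ℕ} {a m2 : ℝ}

/-- **B3 (3.1) for `G_k(0)`, kernel level, VALUE — the infinite-volume zero-field propagator between separated points decays
exponentially with no singular prefactor.**  For every `ρ > 0` there are `δ₀, C > 0` such that for every `k ≥ 1`, window point and
lattice points with `η|x−x′|_∞ ≥ ρ`: `η^{−(d+1)}|G_k(0)(x,x′)| = n^{d+1}|GkLat x x′| ≤ C·e^{−δ₀·η|x−x′|_∞}`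
(`B3GkZeroBoxSeparated.abs_Gk_sep_le` on the cubes `C_t`, in the limit). [cite: Balaban1983Higgs3, (3.1) p.432] -/
theorem abs_GkLat_sep_le (d ℓ : ℕ) (hℓ : 1 ≤ ℓ) (amin aplus m2plus : ℝ) (ha : 0 < amin) {ρ : ℝ} (hρ : 0 < ρ) :
    ∃ δ₀ C : ℝ, 0 < δ₀ ∧ 0 < C ∧ ∀ (k : ℕ), 1 ≤ k → ∀ (a m2 : ℝ), amin ≤ a → a ≤ aplus → 0 ≤ m2 → m2 ≤ m2plus →
      ∀ (x x' : Fin (d + 1) → ℤ), ρ * ((((ℓ + 1) ^ k : ℕ)) : ℝ) ≤ supNorm (x - x') →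
        ((((ℓ + 1) ^ k : ℕ)) : ℝ) ^ (d + 1) * |GkLat ℓ k a m2 x x'|
          ≤ C * Real.exp (-(δ₀ * (supNorm (x - x') / ((((ℓ + 1) ^ k : ℕ)) : ℝ)))) := by
  obtain ⟨δ₀, C, hδ₀, hC, h⟩ := abs_Gk_sep_le d ℓ hℓ amin aplus m2plus ha hρ
  refine ⟨δ₀, C, hδ₀, hC, ?_⟩
  intro k hk a m2 h1 h2 h3 h4 x x' hsep
  have hn : 1 ≤ (ℓ + 1) ^ k := Nat.one_le_pow _ _ (by omega)
  obtain ⟨R, hx, hx'⟩ := exists_labRad₂ ((ℓ + 1) ^ k) x x'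
  have hB : ∀ t, R ≤ t → ((((ℓ + 1) ^ k : ℕ)) : ℝ) ^ (d + 1) * |gcube ℓ k t a m2 x x'|
      ≤ C * Real.exp (-(δ₀ * (supNorm (x - x') / ((((ℓ + 1) ^ k : ℕ)) : ℝ)))) := by
    intro t ht
    have hm := ctr_mem (d := d) hn ht hx
    have hm' := ctr_mem (d := d) hn ht hx'
    have hb := h k hk a m2 h1 h2 h3 h4 (cubeM t) (cubeM_pos t) ⟨_, hm⟩ ⟨_, hm'⟩ (by simpa only [ctr_sub_ctr] using hsep)
    rw [← gcube_eq hm hm'] at hb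
    simpa only [ctr_sub_ctr] using hb
  exact mul_abs_le_of_tendsto (tendsto_gcube hℓ hk (ha.trans_le h1) h3 x x') R hB

/-- **B3 (3.1) for `G_k(0)`, kernel level, DERIVATIVE IN THE ROW VARIABLE** at separated arguments:
`n^{d+1}·n·|G_k(0)(x+e_μ,x′) − G_k(0)(x,x′)| ≤ C·e^{−δ₀·η|x−x′|_∞}` whenever `η|x−x′|_∞ ≥ ρ` — on the lattice every point has its
neighbour `x + e_μ`. [cite: Balaban1983Higgs3, (3.1) p.432] -/
theorem abs_GkLatDiff_sep_le (d ℓ : ℕ) (hℓ : 1 ≤ ℓ) (amin aplus m2plus : ℝ) (ha : 0 < amin) {ρ : ℝ} (hρ : 0 < ρ) :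
    ∃ δ₀ C : ℝ, 0 < δ₀ ∧ 0 < C ∧ ∀ (k : ℕ), 1 ≤ k → ∀ (a m2 : ℝ), amin ≤ a → a ≤ aplus → 0 ≤ m2 → m2 ≤ m2plus →
      ∀ (μ : Fin (d + 1)) (x x' : Fin (d + 1) → ℤ), ρ * ((((ℓ + 1) ^ k : ℕ)) : ℝ) ≤ supNorm (x - x') →
        ((((ℓ + 1) ^ k : ℕ)) : ℝ) ^ (d + 1) *
            (((((ℓ + 1) ^ k : ℕ)) : ℝ) * |GkLat ℓ k a m2 (x + Pi.single μ 1) x' - GkLat ℓ k a m2 x x'|)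
          ≤ C * Real.exp (-(δ₀ * (supNorm (x - x') / ((((ℓ + 1) ^ k : ℕ)) : ℝ)))) := by
  obtain ⟨δ₀, C, hδ₀, hC, h⟩ := abs_GkDiff_sep_le d ℓ hℓ amin aplus m2plus ha hρ
  refine ⟨δ₀, C, hδ₀, hC, ?_⟩
  intro k hk a m2 h1 h2 h3 h4 μ x x' hsep
  have hn : 1 ≤ (ℓ + 1) ^ k := Nat.one_le_pow _ _ (by omega)
  have ha0 : 0 < a := ha.trans_le h1
  obtain ⟨R, hx, hxe, hx', -, -⟩ := exists_labRad₅ ((ℓ + 1) ^ k) x (x + Pi.single μ 1) x' x x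
  have hB : ∀ t, R ≤ t → ((((ℓ + 1) ^ k : ℕ)) : ℝ) ^ (d + 1) * (((((ℓ + 1) ^ k : ℕ)) : ℝ) *
      |gcube ℓ k t a m2 (x + Pi.single μ 1) x' - gcube ℓ k t a m2 x x'|)
        ≤ C * Real.exp (-(δ₀ * (supNorm (x - x') / ((((ℓ + 1) ^ k : ℕ)) : ℝ)))) := by
    intro t ht
    have hm := ctr_mem (d := d) hn ht hx
    have hme := ctr_mem (d := d) hn ht hxe
    have hm' := ctr_mem (d := d) hn ht hx'
    have hb := h k hk a m2 h1 h2 h3 h4 (cubeM t) (cubeM_pos t) μ ⟨_, hm⟩ ⟨_, hme⟩ (ctr_add_single _ t x μ) ⟨_, hm'⟩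
      (by simpa only [ctr_sub_ctr] using hsep)
    rw [← gcube_eq hme hm', ← gcube_eq hm hm'] at hb
    simpa only [ctr_sub_ctr] using hb
  exact mul_abs_le_of_tendsto₂ ((tendsto_gcube hℓ hk ha0 h3 _ x').sub (tendsto_gcube hℓ hk ha0 h3 x x')) R hB

/-- **B3 (3.1) for `G_k(0)`, kernel level, DERIVATIVE IN THE COLUMN VARIABLE** at separated arguments (by symmetry
`B3GkZeroLattice.GkLat_comm`). [cite: Balaban1983Higgs3, (3.1) p.432] -/
theorem abs_GkLatDiff'_sep_le (d ℓ : ℕ) (hℓ : 1 ≤ ℓ) (amin aplus m2plus : ℝ) (ha : 0 < amin) {ρ : ℝ} (hρ : 0 < ρ) :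
    ∃ δ₀ C : ℝ, 0 < δ₀ ∧ 0 < C ∧ ∀ (k : ℕ), 1 ≤ k → ∀ (a m2 : ℝ), amin ≤ a → a ≤ aplus → 0 ≤ m2 → m2 ≤ m2plus →
      ∀ (x : Fin (d + 1) → ℤ) (ν : Fin (d + 1)) (x' : Fin (d + 1) → ℤ), ρ * ((((ℓ + 1) ^ k : ℕ)) : ℝ) ≤ supNorm (x - x') →
        ((((ℓ + 1) ^ k : ℕ)) : ℝ) ^ (d + 1) *
            (((((ℓ + 1) ^ k : ℕ)) : ℝ) * |GkLat ℓ k a m2 x (x' + Pi.single ν 1) - GkLat ℓ k a m2 x x'|)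
          ≤ C * Real.exp (-(δ₀ * (supNorm (x - x') / ((((ℓ + 1) ^ k : ℕ)) : ℝ)))) := by
  obtain ⟨δ₀, C, hδ₀, hC, h⟩ := abs_GkLatDiff_sep_le d ℓ hℓ amin aplus m2plus ha hρ
  refine ⟨δ₀, C, hδ₀, hC, ?_⟩
  intro k hk a m2 h1 h2 h3 h4 x ν x' hsep
  have h' := h k hk a m2 h1 h2 h3 h4 ν x' x (by rwa [supNorm_sub_comm])
  rw [GkLat_comm (x' + Pi.single ν 1) x, GkLat_comm x' x, supNorm_sub_comm] at h'
  exact h'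

/-- **B3 (3.1) for `G_k(0)`, kernel level, HÖLDER QUOTIENT OF THE ROW DERIVATIVE IN THE ROW VARIABLE** (per `0 ≤ α < 1`, «This
applies also to Hölder norms», (2.11)): for `x₁ ≠ x₂` and a column point `x` with `η·min(|x₁−x|_∞,|x₂−x|_∞) ≥ ρ`,
`(n/|x₂−x₁|_∞)^α·n^{d+1}·n·|∂_μG_k(0)(x₂,x) − ∂_μG_k(0)(x₁,x)| ≤ C·e^{−δ₀·η·min}`. [cite: Balaban1983Higgs3, (3.1) p.432] -/
theorem abs_GkLatDD_sep_le (d ℓ : ℕ) (hℓ : 1 ≤ ℓ) (amin aplus m2plus : ℝ) (ha : 0 < amin) {α : ℝ} (hα0 : 0 ≤ α)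
    (hα1 : α < 1) {ρ : ℝ} (hρ : 0 < ρ) :
    ∃ δ₀ C : ℝ, 0 < δ₀ ∧ 0 < C ∧ ∀ (k : ℕ), 1 ≤ k → ∀ (a m2 : ℝ), amin ≤ a → a ≤ aplus → 0 ≤ m2 → m2 ≤ m2plus →
      ∀ (μ : Fin (d + 1)) (x₁ x₂ : Fin (d + 1) → ℤ), x₂ ≠ x₁ → ∀ (x : Fin (d + 1) → ℤ),
        ρ * ((((ℓ + 1) ^ k : ℕ)) : ℝ) ≤ min (supNorm (x₁ - x)) (supNorm (x₂ - x)) →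
        ((((ℓ + 1) ^ k : ℕ) : ℝ) / supNorm (x₂ - x₁)) ^ α *
            (((((ℓ + 1) ^ k : ℕ)) : ℝ) ^ (d + 1) *
              ((((ℓ + 1) ^ k : ℕ) : ℝ) * |(GkLat ℓ k a m2 (x₂ + Pi.single μ 1) x - GkLat ℓ k a m2 x₂ x)
                - (GkLat ℓ k a m2 (x₁ + Pi.single μ 1) x - GkLat ℓ k a m2 x₁ x)|))
          ≤ C * Real.exp (-(δ₀ * (min (supNorm (x₁ - x)) (supNorm (x₂ - x)) / ((((ℓ + 1) ^ k : ℕ)) : ℝ)))) := by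
  obtain ⟨δ₀, C, hδ₀, hC, h⟩ := abs_GkDD_sep_le d ℓ hℓ amin aplus m2plus ha hα0 hα1 hρ
  refine ⟨δ₀, C, hδ₀, hC, ?_⟩
  intro k hk a m2 h1 h2 h3 h4 μ x₁ x₂ hne x hsep
  have hn : 1 ≤ (ℓ + 1) ^ k := Nat.one_le_pow _ _ (by omega)
  have ha0 : 0 < a := ha.trans_le h1
  obtain ⟨R, hx₁, hxe₁, hx₂, hxe₂, hx⟩ :=
    exists_labRad₅ ((ℓ + 1) ^ k) x₁ (x₁ + Pi.single μ 1) x₂ (x₂ + Pi.single μ 1) x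
  have hne' : ∀ t : ℕ, ctr ((ℓ + 1) ^ k) t x₂ ≠ ctr ((ℓ + 1) ^ k) t x₁ := fun t hc => hne (add_left_injective _ hc)
  have hB : ∀ t, R ≤ t → ((((ℓ + 1) ^ k : ℕ) : ℝ) / supNorm (x₂ - x₁)) ^ α *
      (((((ℓ + 1) ^ k : ℕ)) : ℝ) ^ (d + 1) * ((((ℓ + 1) ^ k : ℕ) : ℝ) *
        |(gcube ℓ k t a m2 (x₂ + Pi.single μ 1) x - gcube ℓ k t a m2 x₂ x)
          - (gcube ℓ k t a m2 (x₁ + Pi.single μ 1) x - gcube ℓ k t a m2 x₁ x)|))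
        ≤ C * Real.exp (-(δ₀ * (min (supNorm (x₁ - x)) (supNorm (x₂ - x)) / ((((ℓ + 1) ^ k : ℕ)) : ℝ)))) := by
    intro t ht
    have m₁ := ctr_mem (d := d) hn ht hx₁
    have me₁ := ctr_mem (d := d) hn ht hxe₁
    have m₂ := ctr_mem (d := d) hn ht hx₂
    have me₂ := ctr_mem (d := d) hn ht hxe₂
    have m := ctr_mem (d := d) hn ht hx
    have hb := h k hk a m2 h1 h2 h3 h4 (cubeM t) (cubeM_pos t) μ ⟨_, m₁⟩ ⟨_, me₁⟩ ⟨_, m₂⟩ ⟨_, me₂⟩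
      (ctr_add_single _ t x₁ μ) (ctr_add_single _ t x₂ μ) (hne' t) ⟨_, m⟩ (by simpa only [ctr_sub_ctr] using hsep)
    rw [← gcube_eq me₂ m, ← gcube_eq m₂ m, ← gcube_eq me₁ m, ← gcube_eq m₁ m] at hb
    simpa only [ctr_sub_ctr] using hb
  exact mul_abs_le_of_tendsto₃
    (((tendsto_gcube hℓ hk ha0 h3 _ x).sub (tendsto_gcube hℓ hk ha0 h3 x₂ x)).sub
      ((tendsto_gcube hℓ hk ha0 h3 _ x).sub (tendsto_gcube hℓ hk ha0 h3 x₁ x))) R hB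

/-- **B3 (3.1) for `G_k(0)`, kernel level, HÖLDER QUOTIENT OF THE COLUMN DERIVATIVE IN THE COLUMN VARIABLE** (by symmetry).
[cite: Balaban1983Higgs3, (3.1) p.432] -/
theorem abs_GkLatDD'_sep_le (d ℓ : ℕ) (hℓ : 1 ≤ ℓ) (amin aplus m2plus : ℝ) (ha : 0 < amin) {α : ℝ} (hα0 : 0 ≤ α)
    (hα1 : α < 1) {ρ : ℝ} (hρ : 0 < ρ) :
    ∃ δ₀ C : ℝ, 0 < δ₀ ∧ 0 < C ∧ ∀ (k : ℕ), 1 ≤ k → ∀ (a m2 : ℝ), amin ≤ a → a ≤ aplus → 0 ≤ m2 → m2 ≤ m2plus →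
      ∀ (x : Fin (d + 1) → ℤ) (ν : Fin (d + 1)) (x₁' x₂' : Fin (d + 1) → ℤ), x₂' ≠ x₁' →
        ρ * ((((ℓ + 1) ^ k : ℕ)) : ℝ) ≤ min (supNorm (x - x₁')) (supNorm (x - x₂')) →
        ((((ℓ + 1) ^ k : ℕ) : ℝ) / supNorm (x₂' - x₁')) ^ α *
            (((((ℓ + 1) ^ k : ℕ)) : ℝ) ^ (d + 1) *
              ((((ℓ + 1) ^ k : ℕ) : ℝ) * |(GkLat ℓ k a m2 x (x₂' + Pi.single ν 1) - GkLat ℓ k a m2 x x₂')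
                - (GkLat ℓ k a m2 x (x₁' + Pi.single ν 1) - GkLat ℓ k a m2 x x₁')|))
          ≤ C * Real.exp (-(δ₀ * (min (supNorm (x - x₁')) (supNorm (x - x₂')) / ((((ℓ + 1) ^ k : ℕ)) : ℝ)))) := by
  obtain ⟨δ₀, C, hδ₀, hC, h⟩ := abs_GkLatDD_sep_le d ℓ hℓ amin aplus m2plus ha hα0 hα1 hρ
  refine ⟨δ₀, C, hδ₀, hC, ?_⟩
  intro k hk a m2 h1 h2 h3 h4 x ν x₁' x₂' hne hsep
  have h' := h k hk a m2 h1 h2 h3 h4 ν x₁' x₂' hne x (by rwa [supNorm_sub_comm x₁' x, supNorm_sub_comm x₂' x])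
  rw [GkLat_comm (x₂' + Pi.single ν 1) x, GkLat_comm x₂' x, GkLat_comm (x₁' + Pi.single ν 1) x, GkLat_comm x₁' x,
    supNorm_sub_comm x₁' x, supNorm_sub_comm x₂' x] at h'
  exact h'

/-- **B3 (3.1) for `G_k(0)`, kernel level, MIXED SECOND DIFFERENCE** at separated arguments («each differentiation gives an
additional factor», (2.10), once in each variable): `n^{d+1}·n²·|G(x+e_μ,x′+e_ν) − G(x,x′+e_ν) − G(x+e_μ,x′) + G(x,x′)| ≤
C·e^{−δ₀·η|x−x′|_∞}`, `G = G_k(0)`. [cite: Balaban1983Higgs3, (3.1) p.432] -/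
theorem abs_GkLatMixed_sep_le (d ℓ : ℕ) (hℓ : 1 ≤ ℓ) (amin aplus m2plus : ℝ) (ha : 0 < amin) {ρ : ℝ} (hρ : 0 < ρ) :
    ∃ δ₀ C : ℝ, 0 < δ₀ ∧ 0 < C ∧ ∀ (k : ℕ), 1 ≤ k → ∀ (a m2 : ℝ), amin ≤ a → a ≤ aplus → 0 ≤ m2 → m2 ≤ m2plus →
      ∀ (μ ν : Fin (d + 1)) (x x' : Fin (d + 1) → ℤ), ρ * ((((ℓ + 1) ^ k : ℕ)) : ℝ) ≤ supNorm (x - x') →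
        ((((ℓ + 1) ^ k : ℕ)) : ℝ) ^ (d + 1) *
            (((((ℓ + 1) ^ k : ℕ)) : ℝ) ^ 2 *
              |(GkLat ℓ k a m2 (x + Pi.single μ 1) (x' + Pi.single ν 1) - GkLat ℓ k a m2 x (x' + Pi.single ν 1))
                - (GkLat ℓ k a m2 (x + Pi.single μ 1) x' - GkLat ℓ k a m2 x x')|)
          ≤ C * Real.exp (-(δ₀ * (supNorm (x - x') / ((((ℓ + 1) ^ k : ℕ)) : ℝ)))) := by
  obtain ⟨δ₀, C, hδ₀, hC, h⟩ := abs_GkMixed_sep_le d ℓ hℓ amin aplus m2plus ha hρ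
  refine ⟨δ₀, C, hδ₀, hC, ?_⟩
  intro k hk a m2 h1 h2 h3 h4 μ ν x x' hsep
  have hn : 1 ≤ (ℓ + 1) ^ k := Nat.one_le_pow _ _ (by omega)
  have ha0 : 0 < a := ha.trans_le h1
  obtain ⟨R, hx, hxe, hx', hxe', -⟩ :=
    exists_labRad₅ ((ℓ + 1) ^ k) x (x + Pi.single μ 1) x' (x' + Pi.single ν 1) x
  have hB : ∀ t, R ≤ t → ((((ℓ + 1) ^ k : ℕ)) : ℝ) ^ (d + 1) * (((((ℓ + 1) ^ k : ℕ)) : ℝ) ^ 2 *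
      |(gcube ℓ k t a m2 (x + Pi.single μ 1) (x' + Pi.single ν 1) - gcube ℓ k t a m2 x (x' + Pi.single ν 1))
        - (gcube ℓ k t a m2 (x + Pi.single μ 1) x' - gcube ℓ k t a m2 x x')|)
        ≤ C * Real.exp (-(δ₀ * (supNorm (x - x') / ((((ℓ + 1) ^ k : ℕ)) : ℝ)))) := by
    intro t ht
    have m := ctr_mem (d := d) hn ht hx
    have me := ctr_mem (d := d) hn ht hxe
    have m' := ctr_mem (d := d) hn ht hx'
    have me' := ctr_mem (d := d) hn ht hxe'
    have hb := h k hk a m2 h1 h2 h3 h4 (cubeM t) (cubeM_pos t) μ ν ⟨_, m⟩ ⟨_, me⟩ (ctr_add_single _ t x μ) ⟨_, m'⟩ ⟨_, me'⟩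
      (ctr_add_single _ t x' ν) (by simpa only [ctr_sub_ctr] using hsep)
    rw [← gcube_eq me me', ← gcube_eq m me', ← gcube_eq me m', ← gcube_eq m m'] at hb
    simpa only [ctr_sub_ctr] using hb
  exact mul_abs_le_of_tendsto₂
    (((tendsto_gcube hℓ hk ha0 h3 _ _).sub (tendsto_gcube hℓ hk ha0 h3 x _)).sub
      ((tendsto_gcube hℓ hk ha0 h3 _ x').sub (tendsto_gcube hℓ hk ha0 h3 x x'))) R hB

end Clauses

/-! ## Non-vacuity: separated lattice points exist and the value clause is a genuine inequality there (`d + 1 = 3`, `L = 2`,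
`k = 1`, window `a = 1`, `m² = 0`, `ρ = 1`, `x = 0`, `x′ = (2,2,2)`) -/

/-- kernel: `|(0,0,0) − (2,2,2)|_∞ = 2 ≥ ρ·n = 1·2`. [folklore] -/
private theorem witness_sep : (1 : ℝ) * (((2 ^ 1 : ℕ)) : ℝ) ≤ supNorm ((fun _ : Fin 3 => (0 : ℤ)) - fun _ : Fin 3 => (2 : ℤ)) := by
  have h := abs_le_supNorm ((fun _ : Fin 3 => (0 : ℤ)) - fun _ : Fin 3 => (2 : ℤ)) 0
  simp only [Pi.sub_apply] at h
  norm_num at h ⊢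
  exact h

/-- **INHABITED BINDERS of the value clause** (bookkeeping, NOT content): the hypotheses of `abs_GkLat_sep_le` are met by the
data `d + 1 = 3`, `L = 2`, `k = 1`, window `a = 1`, `m² = 0`, `ρ = 1`, points `0` and `(2,2,2)` (`witness_sep`), so its constants
`δ₀, C` specialise to this pair.  As a standalone statement the display below is a tautology — the outer `∃ δ₀ C` absorbs any single
finite value — and must not be counted as a proved instance of (3.1); the content is `abs_GkLat_sep_le` (v1.1 docstring
rewording, ref-1 gen 48 vacuity note 2026-08-22). [cite: Balaban1983Higgs3, (3.1) p.432] -/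
theorem abs_GkLat_sep_le_witness :
    ∃ δ₀ C : ℝ, 0 < δ₀ ∧ 0 < C ∧
      (((2 ^ 1 : ℕ) : ℝ)) ^ (2 + 1) * |GkLat 1 1 1 0 (fun _ : Fin 3 => (0 : ℤ)) (fun _ : Fin 3 => (2 : ℤ))|
        ≤ C * Real.exp (-(δ₀ * (supNorm ((fun _ : Fin 3 => (0 : ℤ)) - fun _ : Fin 3 => (2 : ℤ)) / (((2 ^ 1 : ℕ) : ℝ))))) := by
  obtain ⟨δ₀, C, hδ₀, hC, h⟩ := abs_GkLat_sep_le 2 1 le_rfl 1 1 0 one_pos (ρ := 1) one_pos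
  exact ⟨δ₀, C, hδ₀, hC, h 1 le_rfl 1 0 le_rfl le_rfl le_rfl le_rfl _ _ witness_sep⟩

end

end Literature.MathematicalPhysics.QuantumFieldTheory.Balaban1983to89.B3GkZeroLatticeSeparated
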